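import Summits.BirchSwinnertonDyer.Rank1Residual.Additive.CensusX42LeadingTerm
import Summits.BirchSwinnertonDyer.Rank1Residual.Additive.GordBranchPAdicGrossZagier
import Summits.BirchSwinnertonDyer.Rank1Residual.X11b.CensusPAdicLeadingTermBridge
import Literature.NumberTheory.EllipticCurves.PAdicLFunctionProofs
import HarnessLib

/-!
# Census relation X4-2 ⟹ the kernel's branch `p`-adic Gross–Zagier input `BranchPAdicGrossZagierAt`
# (the SAME height datum, unit `u = α♭⁻¹`) — one bridge, theorems only (cell `b2b-bsdres`, census
# cell, seat `b2b-bsdres-census-ctyper1`, gen 2; census-lead H-4 hand-off l.1476 "ONE bridge")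

HONEST FRAMING (cell `b2b-bsdres`, run/shared/lean/b2b/bsd-rank1-residual/, verbatim in every
file): the goal of the cell is to DELETE the COMBINATION-SHAPED residual classes of the
Birch–Swinnerton-Dyer formula for ALL analytic-rank `≤ 1` elliptic curves over `ℚ` — "full BSD
formula for every rank `≤ 1` curve in class `C`" assembled STRICTLY from published theorems — so
that the rank-`≤ 1` remainder becomes exactly the CONSTRUCTION-SHAPED classes, which are TYPED
(missing-input `Prop`s), NOT attempted. This is not "finishing BSD". Census cell: research
instrumentation; census output = EVIDENCE / conjecture items, never a Literature fact; X4-2 is a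
CANDIDATE relation; labels / RESIDUAL-MAP marks UNCHANGED; nothing booked. Theorems only: an
IMPLICATION between typed predicates, conditional on the named facts Gross–Zagier I.7.3 (`hGZ`) and
Gross–Zagier–Kolyvagin (`hGZK`) for `#Ш_an ∈ ℚ^×`; nothing asserted about any curve.

WHAT: on the rows `p ≡ 1 (mod 4)`, (G-ord), analytic rank `1`, the typed census relation
`CensusX42.RelationAt W p Dh` (PARI-normalised identity
`ϖ·[T¹]L·log_p(γ_cyc)·#T² = α♭⁻¹·#Ш_an·Reg_p(E,Dh)·∏c`, file `CensusX42LeadingTerm.lean`,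
p252477) IMPLIES team n1011's kernel input `BranchPAdicGrossZagierAt W p Dh`
(`GordBranchPAdicGrossZagier.lean`, p251899: `ϖ·[T^r]B·log_p(γ)^r = u·q·Reg_p(E,Dh)`,
`L^{(r)}/r! = q·Ω_E·Reg_∞`, `u ∈ ℤ_p^×`) FOR THE SAME DATUM `Dh`, with the unit PINNED to
`u = α♭⁻¹` and `q = #Ш_an·∏c/#T²` (definition of `shaAn`). So the census item is not a parallel
obligation: composed with the even-branch lower divisibility it feeds
`cycLowerBoundAt_of_chiBranchLower_of_branchPAdicGrossZagier` /
`ClassX4Gord.missingLowerBoundAt_rankOne_of_…` for the census height (the normalisation datum the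
hand-off asked to keep explicit IS `Dh`; `IsTwistSigmaHeight` of `CensusX42Height.lean` names it).
The odd-branch and (M) twins wait for p01's odd/(M) versions of `BranchPAdicGrossZagierAt`.

References: census X42-REPORT.md (sha256 `e8592c9a…`); B. Gross, D. Zagier, Invent. Math. 84 (1986)
Thm. I.7.3 [GrossZagier1986]; Mazur–Tate–Teitelbaum 1986 §I.13 [MazurTateTeitelbaum1986Invent].
-/

noncomputable section

open scoped Classical MatrixGroups ModularForm

open CongruenceSubgroup WeierstrassCurve Literature.NumberTheory.EllipticCurves
  Literature.NumberTheory.EllipticCurves.ModularForms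
  Literature.NumberTheory.EllipticCurves.Rank1Residual

namespace Summit.BirchSwinnertonDyer.Rank1Residual.Additive

namespace CensusX42

variable (p : ℕ) [hp : Fact p.Prime]

/-- **Census X4-2 ⟹ `BranchPAdicGrossZagierAt` (even branch, (G-ord), rank 1), same `Dh`,
`u = α♭⁻¹`, `q = #Ш_an·∏c/#T²`.** Conditional on `hGZ`/`hGZK` only for `#Ш_an ∈ ℚ^×` and
`rank E(ℚ) = 1`. [cite: GrossZagier1986, Thm. I.(7.3)] [cite: MazurTateTeitelbaum1986Invent, §I.13] -/
theorem branchPAdicGrossZagierAt_of_relationAt (hGZ : GrossZagier1986_thm_I_7_3)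
    (hGZK : rank_eq_analyticRank_of_analyticRank_le_one)
    (W : WeierstrassCurve ℚ) [W.IsElliptic] [W.IsGloballyMinimal] (hadd : Addv W p)
    (hr : W.analyticRank = 1) (Dh : PAdicHeightData W p) (h : RelationAt W p Dh) :
    BranchPAdicGrossZagierAt W p Dh := by
  intro V _ _ N _ f hp4 hVW hord hf ϖ hϖ
  obtain ⟨C, hC⟩ := hVW
  obtain ⟨s, hs0, hs⟩ :=
    X11b.exists_rat_ne_zero_shaAn_eq_of_analyticRank_eq_one hGZ hGZK W hr
  have hord' : IsOrdinaryAt V p := hord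
  obtain ⟨heven, -⟩ := h V C f hadd (Or.inl hord'.1) hf hr s hs
  obtain ⟨hG, -⟩ := heven hp4 hC ϖ hϖ
  obtain ⟨-, -, hid⟩ := hG hord'
  have hrk : W.mordellWeilRank = 1 := by rw [(hGZK W hr.le).1, hr]
  obtain ⟨-, hunit⟩ := unitRoot_spec_holds V p hord'
  -- nonvanishing bookkeeping
  have hT : (W.torsionOrder : ℚ_[p]) ≠ 0 := by exact_mod_cast (W.torsionOrder_pos_holds).ne'
  have hTq : (W.torsionOrder : ℚ) ≠ 0 := by exact_mod_cast (W.torsionOrder_pos_holds).ne'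
  have hΩ : (W.realPeriodRat : ℂ) ≠ 0 := by exact_mod_cast (W.realPeriodRat_pos_holds).ne'
  have hR : (W.regulator : ℂ) ≠ 0 := by exact_mod_cast (W.regulator_pos').ne'
  have hcp : (W.tamagawaProduct : ℂ) ≠ 0 := by
    exact_mod_cast (W.tamagawaProduct_pos_holds : 0 < W.tamagawaProduct).ne'
  have hTc : (W.torsionOrder : ℂ) ≠ 0 := by exact_mod_cast (W.torsionOrder_pos_holds).ne'
  refine ⟨hunit.unit⁻¹, s * W.tamagawaProduct / (W.torsionOrder : ℚ) ^ 2, ?_, ?_⟩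
  · -- `L'(E,1) = q · Ω_E · Reg_∞` from the definition of `#Ш_an`
    have hdef := shaAn_def W
    rw [hs] at hdef
    -- hdef : (s : ℂ) = leadingLCoeff * T² / (Ω * ∏c * Reg)
    have : W.leadingLCoeff = (s : ℂ) * (W.realPeriodRat : ℂ) * (W.tamagawaProduct : ℂ) *
        (W.regulator : ℂ) / (W.torsionOrder : ℂ) ^ 2 := by
      rw [hdef]
      field_simp
    rw [this]
    push_cast
    field_simp
  · -- the identity with `u = α♭⁻¹`
    rw [hrk, pow_one]
    have hu : (((hunit.unit⁻¹ : ℤ_[p]ˣ) : ℤ_[p]) : ℚ_[p]) = ((unitRoot V p : ℤ_[p]) : ℚ_[p])⁻¹ := by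
      symm
      apply inv_eq_of_mul_eq_one_left
      have h1 : ((hunit.unit⁻¹ : ℤ_[p]ˣ) : ℤ_[p]) * unitRoot V p = 1 := by
        have h0 := hunit.unit.inv_mul
        rwa [IsUnit.unit_spec] at h0
      rw [← PadicInt.coe_mul, h1, PadicInt.coe_one]
    rw [hu]
    -- hid : ϖ * [T¹]B * log * T² = α⁻¹ * (s * Reg * ∏c)
    have hid' := hid
    have hgoal : ((ϖ : ℚ) : ℚ_[p]) *
        PowerSeries.coeff 1 (padicLFunctionBranch f ((unitRoot V p : ℤ_[p]) : ℚ_[p]) (p / 2)) *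
        padicLog p (cyclotomicGenerator p) =
        ((unitRoot V p : ℤ_[p]) : ℚ_[p])⁻¹ *
          ((s * W.tamagawaProduct / (W.torsionOrder : ℚ) ^ 2 : ℚ) : ℚ_[p]) * padicRegulator Dh := by
      push_cast
      field_simp
      linear_combination hid'
    exact hgoal

end CensusX42

end Summit.BirchSwinnertonDyer.Rank1Residual.Additive

end
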